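import Summits.BirchSwinnertonDyer.BirchSwinnertonDyer.Theorems.ResidualThetaTransportAtTwoSignedMuVanishingAtTwoPlusKatoLine
import Summits.BirchSwinnertonDyer.BirchSwinnertonDyer.Theorems.ResidualThetaTransportAtTwoSignedMuVanishingAtTwoPlusNeronMuChild
import Literature.NumberTheory.EllipticCurves.Kobayashi2003.SignedSelmerGeneratorChangeProofs
import Literature.NumberTheory.EllipticCurves.Kobayashi2003.SignedSelmerDualExistsProofs
import Literature.NumberTheory.EllipticCurves.Kobayashi2003.SignedSelmerModuleFiniteProofs
import HarnessLib

/-!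
# Route `ResidualThetaTransportAtTwo`, crux Kμ⁺ `SignedMuVanishingAtTwoPlus` (stmt-BirchSwinnertonDyer-20689):
# the crux in the route's CANONICAL binder shape — Kμ⁺ ⟺ (conj.1 at `IsCyclotomicVariable 2 γ`) ∧ (NÉRON-`μ`),
# the `[Module.Finite]` binder is dischargeable, and GRANTED K3 + (PER) + (FLAT): Kμ⁺ ⟺ KATO-INT@2

Cell `bsd-wall`, width seat `bsd-wall-rtt-p4-w2` on the lead line `birth` (v4). THEOREMS ONLY (no `def`, no named
fact, no `sorry`); helper `--supports` the crux; nothing about any curve is asserted and BSD is not proved by this.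
Thin sequel, BY NAME, of rtt-p4-w3's p581306 `…KatoLine` (`muAlgebraic_iff_muAlgebraicCanonical`: the algebraic
conjunct's `(κ, γ)`-binder is idle, via the tree's `Kobayashi2003/SignedSelmerGeneratorChangeProofs`;
`muAlgebraic_iff_integralKato_of_upTo_of_periodUnit_of_flatMuZero`) and of this seat's p579652 `…NeronMuChild`
(child 21437 ⟺ `v₂(ϖ) + μ(L♭_f) = 0`):

* `muAlgebraic_iff_forall_datum` — the `[Module.Finite Λ D.X]` binder of conj.1 is DISCHARGEABLE: every `+` signed
  Selmer dual datum at a top-generator pair is finitely generated (`SignedSelmerDualData.moduleFinite`,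
  `Kobayashi2003/SignedSelmerModuleFiniteProofs` — Greenberg's Nakayama argument, any prime), so conj.1 ⟺
  «torsion ∧ `μ = 0` for EVERY datum»; `isTorsion_and_mu_eq_zero_of_one_pair` — and it holds for every datum at every
  cyclotomic pair as soon as it holds for ONE datum at ONE cyclotomic pair.
* `signedMuVanishingAtTwoPlus_iff_muAlgebraicCanonical_and_padicValRat_add_mu_eq_zero` — **Kμ⁺ ⟺ (conj.1 at the
  canonical variable, the binder of K3 / K4 / `KobayashiMainConjecture` and of the route's `closes`) ∧ (NÉRON-`μ`)**.
* `signedMuVanishingAtTwoPlus_iff_integralKato_of_upTo_of_periodUnit_of_flatMuZero` — GRANTED K3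
  `SignedKatoDivisibilityUpToAtTwo` by name, (PER), (FLAT) and modularity `exists_isNewformOf`: **the WHOLE crux ⟺
  KATO-INT@2** (K3 with exponent `m = 0` plus torsion at the canonical variable) — w3's conjunct-level equivalence
  lifted to the crux (the analytic conjunct is then automatic from (PER) ∧ (FLAT)).

References: S. Kobayashi, Invent. Math. 152 (2003) Thm. 1.2, Thm. 1.3 (i) [Kobayashi2003]; R. Greenberg, LNM 1716
(1999) §1 (p. 60) [Greenberg1999LNM]; L. Washington, GTM 83, §13.1–13.2 [Washington1997]; R. Greenberg, V. Vatsal,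
Invent. Math. 142 (2000) p. 2 (2) [GreenbergVatsal2000]; R. Pollack, Duke Math. J. 118 (2003) Prop. 6.18 [Pollack2003].
-/

set_option autoImplicit false
set_option linter.dupNamespace false

noncomputable section

open scoped Classical MatrixGroups ModularForm

open CongruenceSubgroup WeierstrassCurve Literature.NumberTheory.EllipticCurves
  Literature.NumberTheory.EllipticCurves.ModularForms Literature.NumberTheory.EllipticCurves.IwasawaAlgebra
  Literature.NumberTheory.EllipticCurves.Rank1Residual Literature.NumberTheory.EllipticCurves.Kobayashi2003
  Summit.BirchSwinnertonDyer.Rank1Residual.Supersingular Summit.BirchSwinnertonDyer.Rank1Residual.X1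
  Summit.BirchSwinnertonDyer.BirchSwinnertonDyer.Theses.ResidualThetaTransportAtTwo

namespace Summit.BirchSwinnertonDyer.BirchSwinnertonDyer.Theorems.SignedMuAtTwo

/-! ## §1. Binders of the algebraic conjunct that are idle or dischargeable -/

/-- **The finite-generation binder is dischargeable**: every `+` signed Selmer dual datum at a top-generator pair
is finitely generated over `Λ` (`SignedSelmerDualData.moduleFinite`, Greenberg's Nakayama argument), so conj.1 of
Kμ⁺ ⟺ «`X⁺` torsion ∧ `μ = 0` for EVERY datum». [cite: Greenberg1999LNM, §1 (p. 60)] [cite: Kobayashi2003, Thm. 1.2] -/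
theorem muAlgebraic_iff_forall_datum :
    (∀ (W : WeierstrassCurve ℚ) [W.IsElliptic] [W.IsGloballyMinimal], ¬ W.HasCM → W.analyticRank = 0 →
      GoodSS W 2 → W.frobeniusTrace 2 = 0 → W.Δ < 0 →
      ∀ (κ : ZpExtension ℚ 2) (γ : Field.absoluteGaloisGroup ℚ), κ.IsCyclotomic → κ.IsTopGenerator γ →
      ∀ (D : SignedSelmerDualData W κ γ 1) [Module.Finite (IwasawaAlgebra 2) D.X],
        Module.IsTorsion (IwasawaAlgebra 2) D.X ∧ D.mu = 0) ↔
    (∀ (W : WeierstrassCurve ℚ) [W.IsElliptic] [W.IsGloballyMinimal], ¬ W.HasCM → W.analyticRank = 0 →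
      GoodSS W 2 → W.frobeniusTrace 2 = 0 → W.Δ < 0 →
      ∀ (κ : ZpExtension ℚ 2) (γ : Field.absoluteGaloisGroup ℚ), κ.IsCyclotomic → κ.IsTopGenerator γ →
      ∀ (D : SignedSelmerDualData W κ γ 1), Module.IsTorsion (IwasawaAlgebra 2) D.X ∧ D.mu = 0) := by
  constructor
  · intro h W _ _ hCM hr hss ha hΔ κ γ hκ hγ D
    haveI : Module.Finite (IwasawaAlgebra 2) D.X := D.moduleFinite hγ
    exact h W hCM hr hss ha hΔ κ γ hκ hγ D
  · intro h W _ _ hCM hr hss ha hΔ κ γ hκ hγ D _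
    exact h W hCM hr hss ha hΔ κ γ hκ hγ D

/-- The crux's algebraic conjunct at any habitat⁺ curve holds for every datum (no finite-generation proviso) as
soon as it holds at ONE cyclotomic top-generator pair `(κ₁, γ₁)` for ONE datum `D₁` there.
[cite: Greenberg1999LNM, §1 (p. 60)] [cite: Washington1997, §13.1–13.2] -/
theorem isTorsion_and_mu_eq_zero_of_one_pair {W : WeierstrassCurve ℚ} [W.IsElliptic] [W.IsGloballyMinimal]
    {κ₁ κ : ZpExtension ℚ 2} {γ₁ γ : Field.absoluteGaloisGroup ℚ} (hκ₁ : κ₁.IsCyclotomic)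
    (hγ₁ : κ₁.IsTopGenerator γ₁) (hκ : κ.IsCyclotomic) (hγ : κ.IsTopGenerator γ)
    (D₁ : SignedSelmerDualData W κ₁ γ₁ 1) (h₁ : Module.IsTorsion (IwasawaAlgebra 2) D₁.X ∧ D₁.mu = 0)
    (D : SignedSelmerDualData W κ γ 1) : Module.IsTorsion (IwasawaAlgebra 2) D.X ∧ D.mu = 0 :=
  ⟨SignedSelmerDualData.isTorsion_of_isTorsion_of_isCyclotomic hκ₁ hκ hγ₁ D₁ D h₁.1,
    SignedSelmerDualData.mu_eq_zero_of_mu_eq_zero_of_isCyclotomic hκ₁ hκ hγ₁ hγ D₁ D h₁.1 h₁.2⟩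

/-! ## §2. The crux ⟺ (conj.1 at the canonical variable) ∧ (NÉRON-`μ`) -/

/-- **KERNEL-EXACT READING OF Kμ⁺ in the route's own binder shape**: the crux holds iff (i) at the CANONICAL
cyclotomic variable every (finitely generated) `+` signed Selmer dual of a habitat⁺ curve is torsion with `μ = 0`
and (ii) `v₂(ϖ) + μ(L♭_f) = 0` for every habitat⁺ `(W, f, ϖ, L♯, L♭)` (p579652).
[cite: Greenberg1999LNM, §1 (p. 60)] [cite: GreenbergVatsal2000, p. 2, (2)] [cite: Pollack2003, Prop. 6.18] -/
theorem signedMuVanishingAtTwoPlus_iff_muAlgebraicCanonical_and_padicValRat_add_mu_eq_zero :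
    SignedMuVanishingAtTwoPlus ↔
      (∀ (W : WeierstrassCurve ℚ) [W.IsElliptic] [W.IsGloballyMinimal], ¬ W.HasCM → W.analyticRank = 0 →
        GoodSS W 2 → W.frobeniusTrace 2 = 0 → W.Δ < 0 →
        ∀ (κ : ZpExtension ℚ 2) (γ : Field.absoluteGaloisGroup ℚ), κ.IsCyclotomic → κ.IsTopGenerator γ →
        IsCyclotomicVariable 2 γ →
        ∀ (D : SignedSelmerDualData W κ γ 1) [Module.Finite (IwasawaAlgebra 2) D.X],
          Module.IsTorsion (IwasawaAlgebra 2) D.X ∧ D.mu = 0) ∧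
      (∀ (W : WeierstrassCurve ℚ) [W.IsElliptic] [W.IsGloballyMinimal], ¬ W.HasCM →
        W.analyticRank = 0 → GoodSS W 2 → W.frobeniusTrace 2 = 0 → W.Δ < 0 →
        ∀ [NeZero (W.conductorNorm ℤ)] (f : CuspForm (Gamma0 (W.conductorNorm ℤ)) 2), IsNewformOf W f →
        ∀ (ϖ : ℚ), (ϖ : ℝ) * W.realPeriodRat = plusPeriod f →
        ∀ (Lplus Lminus : IwasawaAlgebra 2), IsPollackPair f 2 Lplus Lminus →
        padicValRat 2 ϖ + MuLambda.mu Lminus = 0) := by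
  rw [← muAlgebraic_iff_muAlgebraicCanonical]
  constructor
  · intro h
    exact ⟨fun W _ _ hCM hr hss ha hΔ ↦ (h W hCM hr hss ha hΔ).1,
      signedMuAnalyticAtTwoPlus_iff_padicValRat_add_mu_eq_zero.mp (signedMuAnalyticAtTwoPlus_of_signedMuVanishingAtTwoPlus h)⟩
  · rintro ⟨halg, hν⟩ W _ _ hCM hr hss ha hΔ
    exact ⟨halg W hCM hr hss ha hΔ, signedMuAnalyticAtTwoPlus_iff_padicValRat_add_mu_eq_zero.mpr hν W hCM hr hss ha hΔ⟩

/-! ## §3. GRANTED K3 + (PER) + (FLAT): the crux ⟺ KATO-INT@2 -/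

/-- **GRANTED K3 (`SignedKatoDivisibilityUpToAtTwo`, by name), (PER) and (FLAT): the WHOLE crux ⟺ KATO-INT@2**
(K3 with exponent `m = 0` plus torsion, at the canonical variable) — rtt-p4-w3's canonical-variable equivalence
lifted to the crux by §1–§2. [cite: Kobayashi2003, Thm. 1.3 (i)] [cite: Kato2004, Thm. 17.4]
[cite: Washington1997, §13.1–13.2] -/
theorem signedMuVanishingAtTwoPlus_iff_integralKato_of_upTo_of_periodUnit_of_flatMuZero
    (hK3 : SignedKatoDivisibilityUpToAtTwo)
    (hper : ∀ (W : WeierstrassCurve ℚ) [W.IsElliptic] [W.IsGloballyMinimal], GoodSS W 2 →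
      ∀ [NeZero (W.conductorNorm ℤ)] (f : CuspForm (Gamma0 (W.conductorNorm ℤ)) 2), IsNewformOf W f →
      ∃ u : ℚ, ‖(u : ℚ_[2])‖ = 1 ∧ W.realPeriodRat = u * plusPeriod f)
    (hflat : ∀ (W : WeierstrassCurve ℚ) [W.IsElliptic] [W.IsGloballyMinimal], ¬ W.HasCM →
      W.analyticRank = 0 → GoodSS W 2 → W.frobeniusTrace 2 = 0 → W.Δ < 0 →
      ∀ [NeZero (W.conductorNorm ℤ)] (f : CuspForm (Gamma0 (W.conductorNorm ℤ)) 2), IsNewformOf W f →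
      ∀ (Lplus Lminus : IwasawaAlgebra 2), IsPollackPair f 2 Lplus Lminus →
      ¬ PowerSeries.C (2 : ℤ_[2]) ∣ Lminus)
    (hnf : exists_isNewformOf) :
    SignedMuVanishingAtTwoPlus ↔
      ∀ (W : WeierstrassCurve ℚ) [W.IsElliptic] [W.IsGloballyMinimal], ¬ W.HasCM → W.analyticRank = 0 →
        GoodSS W 2 → W.frobeniusTrace 2 = 0 → W.Δ < 0 →
        ∀ (κ : ZpExtension ℚ 2) (γ : Field.absoluteGaloisGroup ℚ), κ.IsCyclotomic → κ.IsTopGenerator γ →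
        IsCyclotomicVariable 2 γ →
        ∀ [NeZero (W.conductorNorm ℤ)] (f : CuspForm (Gamma0 (W.conductorNorm ℤ)) 2), IsNewformOf W f →
        ∀ (ϖ : ℚ), (ϖ : ℝ) * W.realPeriodRat = plusPeriod f →
        ∀ (Lplus Lminus : IwasawaAlgebra 2), IsPollackPair f 2 Lplus Lminus →
        ∀ (D : SignedSelmerDualData W κ γ 1) [Module.Finite (IwasawaAlgebra 2) D.X],
          Module.IsTorsion (IwasawaAlgebra 2) D.X ∧
          ∃ g h : IwasawaAlgebra 2, D.charIdeal = Ideal.span {g} ∧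
            iwasawaToPowerSeries 2 (g * h) =
              PowerSeries.C (ϖ : ℚ_[2]) * iwasawaToPowerSeries 2 (kobayashiL 1 Lplus Lminus) := by
  rw [← muAlgebraicCanonical_iff_integralKato_of_upTo_of_periodUnit_of_flatMuZero hK3 hper hflat hnf,
    ← muAlgebraic_iff_muAlgebraicCanonical]
  constructor
  · intro h W _ _ hCM hr hss ha hΔ
    exact (h W hCM hr hss ha hΔ).1
  · intro halg W _ _ hCM hr hss ha hΔ
    exact ⟨halg W hCM hr hss ha hΔ, signedMuAnalyticAtTwoPlus_of_periodUnit_of_flatMuZero hper hflat W hCM hr hss ha hΔ⟩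

end Summit.BirchSwinnertonDyer.BirchSwinnertonDyer.Theorems.SignedMuAtTwo

end
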